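import Literature.AlgebraicTopology.SingularHomology.MayerVietorisExactness
import Literature.AlgebraicTopology.SingularHomology.LocalHomologyVanishing
import Literature.AlgebraicTopology.SingularHomology.SphereComplement
import Mathlib.RingTheory.Noetherian.Basic
import Mathlib.RingTheory.Finiteness.Basic
import HarnessLib

/-!
# Finiteness from the Mayer–Vietoris sequence: the ladder lemma and `Hₙ(A ∪ B)`

First of three files proving that the singular homology of a compact topological manifold is
finitely generated (A. Hatcher, *Algebraic Topology* (2002), Appendix A, Cor. A.8 with Cor. A.9,
p. 527 — the tree's named fact `Literature.AlgebraicTopology.SingularHomology.finite_singularHomology_of_compactSpace`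
of `…PoincareDuality`), *without* CW structures or Euclidean neighbourhood retracts: we run
R. L. Wilder's finiteness argument as presented in G. E. Bredon, *Sheaf Theory* (2nd ed., 1997),
§II.17 (Lemma 17.3 and the proof of Thm. 17.4, condition `(jⁿ)`), for singular homology and the
Mayer–Vietoris sequence of the tree (`Literature.AlgebraicTopology.SingularHomology.mayerVietoris.δ`,
`exact₁/₂/₃_holds`, `δ_naturality_holds`, Hatcher §2.2 pp. 149–150).

This file contains the two generic inputs:

* `Literature.AlgebraicTopology.SingularHomology.fg_range_comp_of_ladder` — Bredon's **ladder lemma** II.17.3 ("small" =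
  finitely generated, over a Noetherian ring): for a diagram with middle row `A₂ → B₂ → C₂` exact
  at `B₂` and vertical maps `B₁ → B₂ → B₃`, if `Im(B₁ → B₂ → C₂)` and `Im(A₂ → B₂ → B₃)` are
  finitely generated then so is `Im(B₁ → B₂ → B₃)`;
* `Literature.AlgebraicTopology.SingularHomology.openUnion.finite_singularHomology` — for open `A, B ⊆ X`, if `Hₙ(A)`, `Hₙ(B)` and
  `Hₙ₋₁(A ∩ B)` are finitely generated then so is `Hₙ(A ∪ B)` (Mayer–Vietoris for the cover of
  the subspace `A ∪ B` by the traces `(A ∪ B) ↓∩ A`, `(A ∪ B) ↓∩ B` of `A` and `B` —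
  `SphereComplement.interior_union_interior_eq_univ` — identified with `A`, `B`, `A ∩ B` by
  `SphereComplement.preimageValHomeomorphOfSubset` of `…SphereComplement`), together with the end
  `H₀(U) ⊞ H₀(V) → H₀(X) → 0` of the Mayer–Vietoris sequence (`mayerVietoris.ψ_surjective_zero`)
  and small range computations used throughout (`range_biprod_desc`, `range_map_comp`,
  `range_map_comp_homeomorph`; `Submodule.fg_range` is Mathlib's).

Continued in `…WilderFiniteness` (the inductive step on unions for images
`Im(Hₙ(V) → Hₙ(U))`, `closure V ⊆ U` compact) and `…CompactManifoldFiniteness` (Euclidean space,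
charts, the discharge). Everything here is proved; there are no definitions; no statement of the tree is modified.

## References

* G. E. Bredon, *Sheaf Theory*, 2nd ed., GTM 170, Springer 1997, §II.17, Lemma 17.3 and
  Thm. 17.4. [Bredon1997]
* A. Hatcher, *Algebraic Topology*, CUP 2002, §2.2 pp. 149–150 (Mayer–Vietoris), Appendix A
  Cor. A.8, A.9 (p. 527). [HatcherAT2002]
-/

noncomputable section

open CategoryTheory Limits Set

universe u v

namespace Literature.AlgebraicTopology.SingularHomology

/-! ### Algebra: finitely generated images across a ladder (Bredon II.17.3) -/

section Ladder

variable {R : Type v} [CommRing R]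
variable {A₂ B₁ B₂ B₃ C₂ : Type*}
  [AddCommGroup A₂] [Module R A₂] [AddCommGroup B₁] [Module R B₁] [AddCommGroup B₂] [Module R B₂]
  [AddCommGroup B₃] [Module R B₃] [AddCommGroup C₂] [Module R C₂]

/-- **The ladder lemma** (Bredon, *Sheaf Theory*, II.17, Lemma 17.3, case "small = finitely
generated", over a Noetherian ring), in Bredon's notation transposed to ours: a commutative diagram
with middle row `A₂ →f₂ B₂ →g₂ C₂` exact at `B₂` (`ker g₂ ≤ range f₂`; Bredon's `B₁ →i B₂ →j B₃`)
and vertical maps `β₁ : B₁ → B₂`, `β₂ : B₂ → B₃` (Bredon's `f`, `g`); if `Im (g₂ ∘ β₁)` (Bredon's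
`Im ks`) and `Im (β₂ ∘ f₂)` (Bredon's `Im th`) are finitely generated, then so is `Im (β₂ ∘ β₁)`
(Bredon's `Im gf`). Chase: finitely many elements of `B₁` account for `g₂(Im β₁)` modulo
`ker g₂ = Im f₂`, whose image under `β₂` is finitely generated. [cite: Bredon1997, II.17 Lemma 17.3] -/
theorem fg_range_comp_of_ladder [IsNoetherianRing R]
    (f₂ : A₂ →ₗ[R] B₂) (g₂ : B₂ →ₗ[R] C₂) (hex : LinearMap.ker g₂ ≤ LinearMap.range f₂)
    (β₁ : B₁ →ₗ[R] B₂) (β₂ : B₂ →ₗ[R] B₃) (hks : (LinearMap.range (g₂ ∘ₗ β₁)).FG)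
    (hth : (LinearMap.range (β₂ ∘ₗ f₂)).FG) :
    (LinearMap.range (β₂ ∘ₗ β₁)).FG := by
  classical
  -- the image of `range β₁` in `C₂` is finitely generated
  have hJ : ((LinearMap.range β₁).map g₂).FG := by rwa [← LinearMap.range_comp]
  obtain ⟨s, hs⟩ := hJ
  have hmem : ∀ c ∈ s, ∃ x : B₁, g₂ (β₁ x) = c := fun c hc ↦ by
    have : c ∈ (LinearMap.range β₁).map g₂ := hs ▸ Submodule.subset_span hc
    obtain ⟨_, ⟨x, rfl⟩, rfl⟩ := this
    exact ⟨x, rfl⟩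
  choose σ hσ using hmem
  let T : Submodule R B₁ := Submodule.span R (Set.range fun c : s ↦ σ c.1 c.2)
  have hT : T.FG := Submodule.fg_span (Set.finite_range _)
  have hJT : (LinearMap.range β₁).map g₂ ≤ T.map (g₂ ∘ₗ β₁) := by
    rw [← hs, Submodule.span_le]
    intro c hc
    exact ⟨σ c hc, Submodule.subset_span ⟨⟨c, hc⟩, rfl⟩, hσ c hc⟩
  refine (Submodule.FG.sup (hT.map (β₂ ∘ₗ β₁)) hth).of_le ?_
  rintro _ ⟨x, rfl⟩
  obtain ⟨y, hy, hxy⟩ := hJT ⟨β₁ x, ⟨x, rfl⟩, rfl⟩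
  have hk : β₁ x - β₁ y ∈ LinearMap.ker g₂ := by
    rw [LinearMap.mem_ker, map_sub, sub_eq_zero]
    exact hxy.symm
  obtain ⟨a, ha⟩ := hex hk
  have : (β₂ ∘ₗ β₁) x = (β₂ ∘ₗ β₁) y + (β₂ ∘ₗ f₂) a := by
    simp only [LinearMap.comp_apply, ha, map_sub]
    abel
  rw [this]
  exact Submodule.add_mem_sup ⟨y, hy, rfl⟩ ⟨a, rfl⟩

end Ladder

/-! ### Ranges of maps on homology: generalities -/

section Biprod

variable {R : Type v} [CommRing R] {P Q T : ModuleCat.{u} R}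

/-- The range of `biprod.desc f g : P ⊞ Q ⟶ T` is `range f ⊔ range g` (elements of a binary
biproduct of modules are `inl a + inr b`). [folklore] -/
lemma range_biprod_desc (f : P ⟶ T) (g : Q ⟶ T) :
    LinearMap.range (biprod.desc f g).hom = LinearMap.range f.hom ⊔ LinearMap.range g.hom := by
  refine le_antisymm ?_ (sup_le ?_ ?_)
  · rintro _ ⟨y, rfl⟩
    change (biprod.desc f g) y ∈ _
    rw [biprod_desc_apply]
    exact Submodule.add_mem_sup ⟨_, rfl⟩ ⟨_, rfl⟩
  · rintro _ ⟨a, rfl⟩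
    exact ⟨(biprod.inl : P ⟶ P ⊞ Q) a, biprod_desc_inl_apply f g a⟩
  · rintro _ ⟨b, rfl⟩
    exact ⟨(biprod.inr : Q ⟶ P ⊞ Q) b, biprod_desc_inr_apply f g b⟩

end Biprod

variable (R : Type v) [CommRing R] (M : Type v) [AddCommGroup M] [Module R M]

section Generalities

variable {R M}
variable {X Y Z : Type u} [TopologicalSpace X] [TopologicalSpace Y] [TopologicalSpace Z]

/-- Finite generation of `Hₙ(-; M)` is invariant under homeomorphism (transport along
`singularHomology.mapIso`; Hatcher 2002, §2.1). [folklore] -/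
lemma finite_singularHomology_of_homeomorph (e : X ≃ₜ Y) (n : ℕ)
    [Module.Finite R (singularHomology R M X n)] : Module.Finite R (singularHomology R M Y n) :=
  Module.Finite.equiv (singularHomology.mapIso R M e n).toLinearEquiv

/-- Precomposing with a homeomorphism does not change the range on homology (`e_*` is onto). [folklore] -/
lemma range_map_comp_homeomorph (e : X ≃ₜ Y) (f : C(Y, Z)) (n : ℕ) :
    LinearMap.range (singularHomology.map R M (f.comp (e : C(X, Y))) n).hom =
      LinearMap.range (singularHomology.map R M f n).hom := by
  rw [singularHomology.map_comp, ModuleCat.hom_comp, LinearMap.range_comp_of_range_eq_top]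
  exact LinearMap.range_eq_top.mpr ((ModuleCat.epi_iff_surjective _).mp
    (inferInstanceAs (Epi (singularHomology.mapIso R M e n).hom)))

/-- `Im ((g ∘ f)_*) = g_* (Im f_*)` on homology (functoriality, Hatcher 2002, §2.1). [folklore] -/
lemma range_map_comp (f : C(X, Y)) (g : C(Y, Z)) (n : ℕ) :
    LinearMap.range (singularHomology.map R M (g.comp f) n).hom =
      (LinearMap.range (singularHomology.map R M f n).hom).map
        (singularHomology.map R M g n).hom := by
  rw [singularHomology.map_comp, ModuleCat.hom_comp, LinearMap.range_comp]

end Generalities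

/-! ### The end of the Mayer–Vietoris sequence: `Hₙ(U) ⊞ Hₙ(V) → H₀(X) → 0` -/

namespace mayerVietoris

variable {X : Type u} [TopologicalSpace X]

/-- **`ψ : H₀(U) ⊞ H₀(V) → H₀(X)` is onto** when the interiors of `U` and `V` cover `X`: the
Mayer–Vietoris sequence ends with `H₀(U) ⊕ H₀(V) → H₀(X) → 0` (Hatcher 2002, §2.2, p. 149).
Chase: for `x ∈ H₀(X)`, the excised class `exc⁻¹ (j_* x) ∈ H₀(U, U ∩ V)` is `j_* a` for some
`a ∈ H₀(U)` (`j_*` is onto in degree `0`, `relativeSingularHomology.epi_ofAbsolute_zero`), and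
then `j_* (x - i_{U*} a) = 0`, so `x - i_{U*} a = i_{V*} b` by exactness of the pair `(X, V)`.
Excision for `X` is the hypothesis `hexc` (as in `mayerVietoris.δ`). [cite: HatcherAT2002, §2.2 p. 149] -/
theorem ψ_surjective_zero (U V : Set X)
    (hexc : relativeSingularHomology.isIso_map_of_interior_union_interior R M X)
    (h : interior U ∪ interior V = Set.univ) :
    Function.Surjective (ψ R M U V 0) := by
  haveI := isIso_excisionMap R M U V hexc h 0
  intro x
  haveI := relativeSingularHomology.epi_ofAbsolute_zero R M (X := ↥U) (Subtype.val ⁻¹' V)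
  obtain ⟨a, ha⟩ := (ModuleCat.epi_iff_surjective
    (relativeSingularHomology.ofAbsolute R M (↥U) (Subtype.val ⁻¹' V) 0)).mp inferInstance
      (inv (excisionMap R M U V 0) (relativeSingularHomology.ofAbsolute R M X V 0 x))
  have h2 : relativeSingularHomology.ofAbsolute R M X V 0
      (x - singularHomology.map R M (subsetIncl U) 0 a) = 0 := by
    have e := congrArg (excisionMap R M U V 0) ha
    rw [← ModuleCat.comp_apply (inv (excisionMap R M U V 0)) (excisionMap R M U V 0),
      IsIso.inv_hom_id, ModuleCat.id_apply, ← ModuleCat.comp_apply, excisionMap,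
      relativeSingularHomology.ofAbsolute_comp_map, ModuleCat.comp_apply] at e
    rw [map_sub, ← e, sub_self]
  obtain ⟨b, hb⟩ := (ShortComplex.moduleCat_exact_iff _).mp
    (relativeSingularHomology.exact_map_ofAbsolute R M (X := X) V 0) _ h2
  change singularHomology.map R M (subsetIncl V) 0 b = _ at hb
  refine ⟨(biprod.inl : singularHomology R M U 0 ⟶
      singularHomology R M U 0 ⊞ singularHomology R M V 0) a +
    (biprod.inr : singularHomology R M V 0 ⟶
      singularHomology R M U 0 ⊞ singularHomology R M V 0) b, ?_⟩
  rw [map_add, ψ, biprod_desc_inl_apply, biprod_desc_inr_apply, hb, add_sub_cancel]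

end mayerVietoris

/-! ### Mayer–Vietoris for the union of two open subsets of a space -/

namespace openUnion

variable {X : Type u} [TopologicalSpace X] {A B : Set X}

/-- **Finite generation of `Hₙ(A ∪ B)` by Mayer–Vietoris.** For open `A, B ⊆ X` and a Noetherian
coefficient ring: if `Hₙ(A)`, `Hₙ(B)` and (for `n ≥ 1`) `Hₙ₋₁(A ∩ B)` are finitely generated,
then so is `Hₙ(A ∪ B)` — it is an extension of `Im δ ⊆ Hₙ₋₁(A ∩ B)` by `Im ψ = ker δ`, a
quotient of `Hₙ(A) ⊕ Hₙ(B)` (Hatcher 2002, §2.2 p. 149; the first step of the induction in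
Bredon 1997, II.17, proof of Thm. 17.4). The Mayer–Vietoris sequence is that of the cover of the
subspace `A ∪ B` by the traces `(A ∪ B) ↓∩ A`, `(A ∪ B) ↓∩ B`
(`SphereComplement.interior_union_interior_eq_univ`), identified with `A`, `B`, `A ∩ B` through
`SphereComplement.preimageValHomeomorphOfSubset`. [cite: HatcherAT2002, §2.2 p. 149] -/
theorem finite_singularHomology [IsNoetherianRing R] (hA : IsOpen A) (hB : IsOpen B) (n : ℕ)
    (hfA : Module.Finite R (singularHomology R M A n))
    (hfB : Module.Finite R (singularHomology R M B n))
    (hfAB : ∀ m, m + 1 = n → Module.Finite R (singularHomology R M ↥(A ∩ B) m)) :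
    Module.Finite R (singularHomology R M ↥(A ∪ B) n) := by
  have hexc := relativeSingularHomology.isIso_map_of_interior_union_interior_holds R M
    (X := ↥(A ∪ B))
  have hcov := SphereComplement.interior_union_interior_eq_univ hA hB
  haveI : Module.Finite R (singularHomology R M ↥(Subtype.val ⁻¹' A : Set ↥(A ∪ B)) n) :=
    finite_singularHomology_of_homeomorph
      (SphereComplement.preimageValHomeomorphOfSubset (subset_union_left : A ⊆ A ∪ B)).symm n
  haveI : Module.Finite R (singularHomology R M ↥(Subtype.val ⁻¹' B : Set ↥(A ∪ B)) n) :=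
    finite_singularHomology_of_homeomorph
      (SphereComplement.preimageValHomeomorphOfSubset (subset_union_right : B ⊆ A ∪ B)).symm n
  have hψ : (LinearMap.range (mayerVietoris.ψ R M (Subtype.val ⁻¹' A : Set ↥(A ∪ B))
      (Subtype.val ⁻¹' B) n).hom).FG := by
    rw [mayerVietoris.ψ, range_biprod_desc]
    exact (Submodule.fg_range _).sup (Submodule.fg_range _)
  cases n with
  | zero =>
    refine ⟨?_⟩
    rwa [LinearMap.range_eq_top.mpr (mayerVietoris.ψ_surjective_zero R M _ _ hexc hcov)] at hψ
  | succ m =>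
    haveI : Module.Finite R (singularHomology R M
        ↥((Subtype.val ⁻¹' A : Set ↥(A ∪ B)) ∩ Subtype.val ⁻¹' B) m) :=
      haveI := hfAB m rfl
      finite_singularHomology_of_homeomorph
        (SphereComplement.preimageValHomeomorphOfSubset
          (inter_subset_left.trans subset_union_left : A ∩ B ⊆ A ∪ B)).symm m
    refine ⟨Submodule.fg_of_fg_map_of_fg_inf_ker
      (mayerVietoris.δ R M (Subtype.val ⁻¹' A : Set ↥(A ∪ B)) (Subtype.val ⁻¹' B)
        hexc hcov m).hom ?_ ?_⟩
    · exact Module.Finite.fg_top.of_le le_top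
    · rw [top_inf_eq, ← (mayerVietoris.exact₂_holds R M (Subtype.val ⁻¹' A : Set ↥(A ∪ B))
        (Subtype.val ⁻¹' B) hexc hcov m).moduleCat_range_eq_ker]
      exact hψ

end openUnion

end Literature.AlgebraicTopology.SingularHomology
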